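import Summits.Schanuel.Schanuel.Theorems.DiophantineDichotomyApproximationPropertyZeroDimDictionaryZeros
import HarnessLib

/-!
# The 0-dimensional dictionary, II: the degree of the field of a zero and the splitting over the embeddings

Crux `stmt-Schanuel-6117` (`Summit.Schanuel.Schanuel.Theses.DiophantineDichotomy.ApproximationProperty`),
line `orbit-interpolation-determinant`, registered stub `stub_zeroDimDictionary : ZeroDimDictionary`
(proved in `DiophantineDichotomyApproximationPropertyZeroDimDictionary.lean`); sequel of
`…ZeroDimDictionaryZeros.lean`. For a homogeneous prime `𝔭 ⊂ ℚ[x₀, …, x_m]` of rank `1` and a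
normalised zero `b̄'` (`b'_j = 1`) with field `K = ℚ(b̄') ⊆ ℂ`, everything PROVED:

* `embedding_eq_of_proportional` (B′), `map_mem_projZeros`, `linC_map_dvd` — conjugates of `b̄` are
  zeros, distinct embeddings give non-proportional conjugates, and every `ℓ_{σ(b̄)}` divides `g`;
* `finrank_le_ideg` — `[K:ℚ] ≤ deg 𝔭` (the `[K:ℚ]` conjugates `σ(b̄)` are pairwise non-proportional
  zeros whose linear forms divide the one-block form `g` of degree `deg 𝔭`);
* `ideg_le_finrank` — `deg 𝔭 ≤ [K:ℚ]`: the associated form is irreducible of degree `deg 𝔭` as a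
  polynomial in `u_j` over `ℚ(u_k : k ≠ j)` (the tree's `GSec.irreducible_Fplus_map`); specialising
  the `u_k` to algebraically independent complex numbers `z_k` (`exists_injective_aeval`) embeds that
  field in `ℂ`, and `θ = −∑ z_k b'_k` is a root of degree `deg 𝔭` lying in the span of a `ℚ`-basis
  of `K`;
* `finrank_eq_ideg` (B), `exists_split_embeddings` — `g = c ∏_σ ℓ_{σ(b̄)}` over the complex
  embeddings of `K` —, `mem_projZeros_iff` (A): `V(𝔭) = {λ σ(b̄)}`;
* `stub_zeroDimDictionary_degree` — the registered sub-goal of this file.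

Sources: Nesterenko, LNM 1752 Ch. 3 §4 (Prop. 4.4); Hodge–Pedoe II Ch. X §7.
-/

noncomputable section

-- `Summit.Schanuel.Schanuel.…` is the mandated summit/sub-problem namespace (single-conjunct summit), hence:
set_option linter.dupNamespace false

namespace Summit.Schanuel.Schanuel.Cruxes.ApproximationProperty.OrbitInterpolationDeterminant

open Literature.NumberTheory.Transcendental.Nesterenko MvPolynomial
open scoped BigOperators

variable {m : ℕ}

section Field

variable {𝔭 : Ideal (Rx m)}

/-- **(B′) Distinct embeddings give distinct projective points**: if `σ ∘ b = λ · τ ∘ b` then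
`λ = 1` (at the coordinate `b_j = 1`) and `σ = τ` (the `b_k` generate `K`). [folklore] -/
theorem embedding_eq_of_proportional {b' : Fin (m + 1) → ℂ} {j : Fin (m + 1)} (hj : b' j = 1)
    {b : Fin (m + 1) → ↥(IntermediateField.adjoin ℚ (Set.range b'))} (hb : ∀ k, (b k : ℂ) = b' k)
    (σ τ : ↥(IntermediateField.adjoin ℚ (Set.range b')) →+* ℂ) (l : ℂ)
    (h : (fun k => σ (b k)) = fun k => l * τ (b k)) : σ = τ := by
  have hbj : b j = 1 := Subtype.ext (by rw [hb, hj]; rfl)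
  have hl : l = 1 := by
    have := congrFun h j
    simp only [hbj, map_one, mul_one] at this
    exact this.symm
  rw [hl] at h
  simp only [one_mul] at h
  suffices hστ : σ.toRatAlgHom = τ.toRatAlgHom by
    exact RingHom.ext fun x => by simpa using congrArg (fun φ => φ x) hστ
  refine IntermediateField.algHom_ext_of_eq_adjoin ℚ (S := IntermediateField.adjoin ℚ (Set.range b'))
    (s := Set.range b') rfl ?_
  rintro x ⟨k, rfl⟩
  have hx : (⟨b' k, IntermediateField.subset_adjoin ℚ _ ⟨k, rfl⟩⟩ :
      ↥(IntermediateField.adjoin ℚ (Set.range b'))) = b k := Subtype.ext (hb k).symm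
  rw [hx]
  exact congrFun h k

/-- **Conjugates of a zero are zeros** (`𝔭` has rational coefficients). [folklore] -/
theorem map_mem_projZeros {b' : Fin (m + 1) → ℂ} (hb' : b' ∈ projZeros 𝔭) {j : Fin (m + 1)}
    (hj : b' j = 1) {b : Fin (m + 1) → ↥(IntermediateField.adjoin ℚ (Set.range b'))}
    (hb : ∀ k, (b k : ℂ) = b' k) (σ : ↥(IntermediateField.adjoin ℚ (Set.range b')) →+* ℂ) :
    (fun k => σ (b k)) ∈ projZeros 𝔭 := by
  have hbj : b j = 1 := Subtype.ext (by rw [hb, hj]; rfl)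
  refine ⟨fun h => ?_, fun P hP => ?_⟩
  · have := congrFun h j
    rw [hbj, map_one] at this
    exact one_ne_zero this
  · have h1 : aeval b P = 0 := by
      apply Subtype.ext
      have h2 : ((aeval b P : ↥(IntermediateField.adjoin ℚ (Set.range b'))) : ℂ) = aeval b' P := by
        have h := comp_aeval_apply (R := ℚ) (f := b) (φ := IntermediateField.val _) (p := P)
        rw [IntermediateField.coe_val] at h
        exact h.trans (congrArg (fun f => aeval f P) (funext fun k => hb k))
      rw [h2, hb'.2 P hP]
      rfl
    have h3 : aeval (fun k => σ (b k)) P = σ (aeval b P) :=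
      (comp_aeval_apply (f := b) (φ := σ.toRatAlgHom) (p := P)).symm
    rw [h3, h1, map_zero]


/-- The linear form of every conjugate point divides the one-block form. [folklore] -/
theorem linC_map_dvd (h𝔭 : 𝔭.IsPrime)
    (hhom : letI := MvPolynomial.gradedAlgebra (σ := Fin (m + 1)) (R := ℚ);
      𝔭.IsHomogeneous (homogeneousSubmodule (Fin (m + 1)) ℚ)) (hunm : IsUnmixedOfRank 𝔭 1)
    {b' : Fin (m + 1) → ℂ} (hb' : b' ∈ projZeros 𝔭) {j : Fin (m + 1)} (hj : b' j = 1)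
    {b : Fin (m + 1) → ↥(IntermediateField.adjoin ℚ (Set.range b'))} (hb : ∀ k, (b k : ℂ) = b' k)
    (σ : ↥(IntermediateField.adjoin ℚ (Set.range b')) →+* ℂ) :
    ((∑ k, C (σ (b k)) * X k) : MvPolynomial (Fin (m + 1)) ℂ) ∣
      rename Prod.snd (map (algebraMap ℚ ℂ) (chowForm 𝔭 1)) :=
  linC_dvd_of_forall_eval (map_mem_projZeros hb' hj hb σ).1 fun u hu =>
    (eval_oneBlock_eq_zero_iff h𝔭 hhom hunm u).mpr ⟨_, map_mem_projZeros hb' hj hb σ, hu⟩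

/-- **`[ℚ(b̄') : ℚ] ≤ deg 𝔭`**: the `[K:ℚ]` complex embeddings of `K = ℚ(b̄')` give pairwise
non-proportional zeros `σ(b̄)` of `𝔭`, whose linear forms all divide the one-block form of degree
`deg 𝔭`. [cite: NesterenkoPhilippon2001, Ch. 3 Prop. 4.4 (p. 38)] -/
theorem finrank_le_ideg (h𝔭 : 𝔭.IsPrime)
    (hhom : letI := MvPolynomial.gradedAlgebra (σ := Fin (m + 1)) (R := ℚ);
      𝔭.IsHomogeneous (homogeneousSubmodule (Fin (m + 1)) ℚ)) (hunm : IsUnmixedOfRank 𝔭 1)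
    {b' : Fin (m + 1) → ℂ} (hb' : b' ∈ projZeros 𝔭) {j : Fin (m + 1)} (hj : b' j = 1)
    [NumberField ↥(IntermediateField.adjoin ℚ (Set.range b'))]
    {b : Fin (m + 1) → ↥(IntermediateField.adjoin ℚ (Set.range b'))} (hb : ∀ k, (b k : ℂ) = b' k) :
    Module.finrank ℚ ↥(IntermediateField.adjoin ℚ (Set.range b')) ≤ ideg 𝔭 1 := by
  classical
  have hinj : Function.Injective
      (fun (σ : ↥(IntermediateField.adjoin ℚ (Set.range b')) →+* ℂ) (k : Fin (m + 1)) => σ (b k)) :=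
    fun σ τ h => embedding_eq_of_proportional hj hb σ τ 1 (by simpa using h)
  obtain ⟨hg0, -, -, hdeg⟩ := oneBlock_facts h𝔭 hhom hunm
  have hcard := card_le_totalDegree_of_linC_dvd hg0
    (Finset.univ.image fun (σ : ↥(IntermediateField.adjoin ℚ (Set.range b')) →+* ℂ) (k : Fin (m + 1)) =>
      σ (b k)) ?_ ?_ ?_
  · rw [hdeg, Finset.card_image_of_injective _ hinj, Finset.card_univ,
      NumberField.Embeddings.card] at hcard
    exact hcard
  · intro β hβ
    obtain ⟨σ, -, rfl⟩ := Finset.mem_image.mp hβ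
    exact (map_mem_projZeros hb' hj hb σ).1
  · intro β hβ β' hβ' hne c hc
    obtain ⟨σ, -, rfl⟩ := Finset.mem_image.mp hβ
    obtain ⟨τ, -, rfl⟩ := Finset.mem_image.mp hβ'
    apply hne
    have : τ = σ := embedding_eq_of_proportional hj hb τ σ c (by
      funext k; simpa using congrFun hc k)
    rw [this]
  · intro β hβ
    obtain ⟨σ, -, rfl⟩ := Finset.mem_image.mp hβ
    exact linC_map_dvd h𝔭 hhom hunm hb' hj hb σ

/-- **`deg 𝔭 ≤ [ℚ(b̄') : ℚ]`.** With the chart `x_j ∉ 𝔭`, the associated form `F`, read as a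
polynomial `F⁺(T)` in `T = u_j` over `A⁺ = ℚ[u_k : k ≠ j]`, is irreducible of degree `deg 𝔭`
(`GSec.irreducible_Fplus_map`, Gauss). Specialise the `u_k`, `k ≠ j`, to algebraically independent
complex numbers `z_k` (`exists_injective_aeval`), so that `K'⁺ = Frac A⁺` embeds in `ℂ`; then
`θ = −∑_{k≠j} z_k b'_k` is a root of `F⁺` (the hyperplane `(z, θ)` passes through `b̄'`), so
`[K'⁺(θ) : K'⁺] = deg 𝔭`, while `K'⁺(θ) ⊆ K'⁺ · ℚ(b̄')` is spanned over `K'⁺` by a `ℚ`-basis of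
`ℚ(b̄')`. [cite: NesterenkoPhilippon2001, Ch. 3 Prop. 4.4 (p. 38); HodgePedoe1994, Ch. X §7] -/
theorem ideg_le_finrank (h𝔭 : 𝔭.IsPrime)
    (hhom : letI := MvPolynomial.gradedAlgebra (σ := Fin (m + 1)) (R := ℚ);
      𝔭.IsHomogeneous (homogeneousSubmodule (Fin (m + 1)) ℚ)) (hunm : IsUnmixedOfRank 𝔭 1)
    {b' : Fin (m + 1) → ℂ} (hb' : b' ∈ projZeros 𝔭) {j : Fin (m + 1)} (hj : b' j = 1)
    [FiniteDimensional ℚ ↥(IntermediateField.adjoin ℚ (Set.range b'))] :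
    ideg 𝔭 1 ≤ Module.finrank ℚ ↥(IntermediateField.adjoin ℚ (Set.range b')) := by
  classical
  obtain ⟨-, -, -, -, -, hmem⟩ := chowForm_facts h𝔭 hhom hunm
  -- the generic-section data at `s = 0` in the chart `j`
  let 𝒢 : GSec m :=
    ⟨𝔭, 0, j, h𝔭, hhom, X_notMem_of_apply_eq_one hb' hj, rank_eq_zero_add_one h𝔭 hunm⟩
  -- algebraically independent complex values for the variables `u_v`, `v ≠ (0, j)`
  obtain ⟨z, hz⟩ := exists_injective_aeval 𝒢.Vp
  set ψ : 𝒢.Ap →+* ℂ := (aeval z : 𝒢.Ap →ₐ[ℚ] ℂ).toRingHom with hψ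
  have hψinj : Function.Injective ψ := hz
  let ι : 𝒢.Kpp →+* ℂ := IsFractionRing.lift hψinj
  letI : Algebra 𝒢.Kpp ℂ := ι.toAlgebra
  have hιA : ∀ a : 𝒢.Ap, algebraMap 𝒢.Kpp ℂ (algebraMap 𝒢.Ap 𝒢.Kpp a) = ψ a := fun a =>
    IsFractionRing.lift_algebraMap hψinj a
  -- the hyperplane `(z ; θ)` through `b̄'`
  set zf : Fin (m + 1) → ℂ := fun k =>
    if h : k = j then 0 else z ⟨(Fin.last 0, k), fun e => h (Prod.mk.inj e).2⟩ with hzf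
  have hzfj : zf j = 0 := by simp [hzf]
  set θ : ℂ := -∑ k, zf k * b' k with hθ
  set u : Fin (0 + 1) × Fin (m + 1) → ℂ := fun v => if v.2 = j then θ else zf v.2 with hu
  have hfin1 : ∀ a c : Fin (0 + 1), a = c := fun a c => Fin.ext (by omega)
  -- `F⁺(θ) = F(z ; θ)`
  have heval : ∀ G : RU (0 + 1) m, Polynomial.eval₂ ψ θ (𝒢.splitEquiv G) = aeval u G := by
    intro G
    have h : (Polynomial.eval₂RingHom ψ θ).comp
        (𝒢.splitEquiv : RU (0 + 1) m →+* Polynomial 𝒢.Ap) =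
        (aeval u : RU (0 + 1) m →ₐ[ℚ] ℂ).toRingHom := by
      refine MvPolynomial.ringHom_ext (fun q => ?_) (fun v => ?_)
      · simp only [RingHom.comp_apply, RingHom.coe_coe, Polynomial.coe_eval₂RingHom,
          AlgHom.toRingHom_eq_coe]
        rw [← MvPolynomial.algebraMap_eq, AlgEquiv.commutes, Polynomial.algebraMap_apply,
          Polynomial.eval₂_C, AlgHom.commutes, hψ, MvPolynomial.algebraMap_eq]
        simp
      · simp only [RingHom.comp_apply, RingHom.coe_coe, Polynomial.coe_eval₂RingHom,
          AlgHom.toRingHom_eq_coe, aeval_X]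
        by_cases hv : v = (Fin.last 0, j)
        · subst hv
          rw [GSec.splitEquiv_X_self, Polynomial.eval₂_X, hu]
          simp
        · rw [𝒢.splitEquiv_X_of_ne hv, Polynomial.eval₂_C, hψ]
          have hv2 : v.2 ≠ j := fun h2 => hv (Prod.ext (hfin1 _ _) h2)
          simp only [AlgHom.toRingHom_eq_coe, RingHom.coe_coe, aeval_X, hu, if_neg hv2, hzf,
            dif_neg hv2]
          exact congrArg z (Subtype.ext (Prod.ext (hfin1 _ _) rfl))
    exact RingHom.congr_fun h G
  -- `θ` is a root of `F⁺`
  have hroot : Polynomial.aeval θ (𝒢.Fplus.map (algebraMap 𝒢.Ap 𝒢.Kpp)) = 0 := by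
    rw [Polynomial.aeval_def, Polynomial.eval₂_map,
      show (algebraMap 𝒢.Kpp ℂ).comp (algebraMap 𝒢.Ap 𝒢.Kpp) = ψ from RingHom.ext hιA]
    change Polynomial.eval₂ ψ θ (𝒢.splitEquiv (chowForm 𝔭 1)) = 0
    rw [heval]
    refine aeval_eq_zero_of_mem_elimIdeal hmem hb' fun i => ?_
    have e : ∀ k, u (i, k) * b' k = (if k = j then θ * b' k else 0) + zf k * b' k := by
      intro k
      simp only [hu]
      split_ifs with hk
      · subst hk; rw [hzfj]; ring
      · ring
    simp_rw [e]
    rw [Finset.sum_add_distrib, Finset.sum_ite_eq' Finset.univ j, if_pos (Finset.mem_univ _), hj,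
      mul_one, hθ]
    ring
  -- hence `[K'⁺(θ) : K'⁺] = deg 𝔭`
  have hFK0 : 𝒢.Fplus.map (algebraMap 𝒢.Ap 𝒢.Kpp) ≠ 0 :=
    (Polynomial.map_ne_zero_iff (IsFractionRing.injective 𝒢.Ap 𝒢.Kpp)).mpr 𝒢.Fplus_ne_zero
  have halg : IsAlgebraic 𝒢.Kpp θ := ⟨_, hFK0, hroot⟩
  have hθint : IsIntegral 𝒢.Kpp θ := halg.isIntegral
  have hfin : Module.finrank 𝒢.Kpp ↥(IntermediateField.adjoin 𝒢.Kpp {θ}) = ideg 𝔭 1 := by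
    rw [IntermediateField.adjoin.finrank hθint,
      ← minpoly.eq_of_irreducible 𝒢.irreducible_Fplus_map hroot, Polynomial.natDegree_mul_C,
      Polynomial.natDegree_map_eq_of_injective (IsFractionRing.injective 𝒢.Ap 𝒢.Kpp),
      𝒢.natDegree_Fplus]
    exact inv_ne_zero (Polynomial.leadingCoeff_ne_zero.mpr hFK0)
  -- a `ℚ`-basis of `K = ℚ(b̄')` spans `K'⁺[θ] ⊆ K'⁺[K]` over `K'⁺`
  set K : IntermediateField ℚ ℂ := IntermediateField.adjoin ℚ (Set.range b') with hK
  set B := Module.finBasis ℚ ↥K with hB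
  set f : Fin (Module.finrank ℚ ↥K) → ℂ := fun i => (B i : ℂ) with hf
  have hKspan : (K : Set ℂ) ⊆ Submodule.span 𝒢.Kpp (Set.range f) := by
    intro x hx
    have hx' : (⟨x, hx⟩ : ↥K) = ∑ i, B.repr ⟨x, hx⟩ i • B i := (B.sum_repr _).symm
    have hxv : x = ∑ i, ((B.repr ⟨x, hx⟩ i : ℚ) : ℂ) * f i := by
      have h1 := congrArg (fun y : ↥K => (y : ℂ)) hx'
      simp only [IntermediateField.coe_sum, IntermediateField.coe_smul] at h1
      exact h1.trans (Finset.sum_congr rfl fun i _ => by rw [Rat.smul_def])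
    rw [hxv]
    refine Submodule.sum_mem _ fun i _ => ?_
    rw [show ((B.repr ⟨x, hx⟩ i : ℚ) : ℂ) * f i = ((B.repr ⟨x, hx⟩ i : ℚ) : 𝒢.Kpp) • f i by
      rw [Algebra.smul_def, RingHom.algebraMap_toAlgebra, map_ratCast]]
    exact Submodule.smul_mem _ _ (Submodule.subset_span ⟨i, rfl⟩)
  have hθmem : θ ∈ Algebra.adjoin 𝒢.Kpp (K : Set ℂ) := by
    refine Subalgebra.neg_mem _ (Subalgebra.sum_mem _ fun k _ => Subalgebra.mul_mem _ ?_ ?_)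
    · by_cases hk : k = j
      · subst hk; rw [hzfj]; exact Subalgebra.zero_mem _
      · have e : zf k = algebraMap 𝒢.Kpp ℂ (algebraMap 𝒢.Ap 𝒢.Kpp
            (X ⟨(Fin.last 0, k), fun e => hk (Prod.mk.inj e).2⟩)) := by
          rw [hιA, hψ, AlgHom.toRingHom_eq_coe, RingHom.coe_coe, aeval_X, hzf]
          simp only [dif_neg hk]
        rw [e]
        exact Subalgebra.algebraMap_mem _ _
    · exact Algebra.subset_adjoin (IntermediateField.subset_adjoin ℚ _ ⟨k, rfl⟩)
  have hadj : Subalgebra.toSubmodule (Algebra.adjoin 𝒢.Kpp (K : Set ℂ)) ≤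
      Submodule.span 𝒢.Kpp (Set.range f) := by
    rw [Algebra.adjoin_eq_span, Submodule.span_le]
    have hcl : (Submonoid.closure (K : Set ℂ) : Set ℂ) = K :=
      congrArg _ (Submonoid.closure_eq K.toSubalgebra.toSubsemiring.toSubmonoid)
    rw [hcl]
    exact hKspan
  have hle : Subalgebra.toSubmodule (IntermediateField.adjoin 𝒢.Kpp {θ}).toSubalgebra ≤
      Submodule.span 𝒢.Kpp (Set.range f) := by
    rw [IntermediateField.adjoin_simple_toSubalgebra_of_isAlgebraic halg]
    exact le_trans (Subalgebra.toSubmodule.monotone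
      (Algebra.adjoin_le (Set.singleton_subset_iff.mpr hθmem))) hadj
  haveI : FiniteDimensional 𝒢.Kpp ↥(Submodule.span 𝒢.Kpp (Set.range f)) :=
    FiniteDimensional.span_of_finite _ (Set.finite_range f)
  calc ideg 𝔭 1 = Module.finrank 𝒢.Kpp ↥(IntermediateField.adjoin 𝒢.Kpp {θ}) := hfin.symm
    _ = Module.finrank 𝒢.Kpp
          ↥(Subalgebra.toSubmodule (IntermediateField.adjoin 𝒢.Kpp {θ}).toSubalgebra) := by
        rw [Subalgebra.finrank_toSubmodule, IntermediateField.finrank_eq_finrank_subalgebra]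
    _ ≤ Module.finrank 𝒢.Kpp ↥(Submodule.span 𝒢.Kpp (Set.range f)) := Submodule.finrank_mono hle
    _ ≤ Fintype.card (Fin (Module.finrank ℚ ↥K)) := finrank_range_le_card f
    _ = Module.finrank ℚ ↥K := Fintype.card_fin _

/-- **(B) `[ℚ(b̄') : ℚ] = deg 𝔭`.** [cite: NesterenkoPhilippon2001, Ch. 3 Prop. 4.4 (p. 38)] -/
theorem finrank_eq_ideg (h𝔭 : 𝔭.IsPrime)
    (hhom : letI := MvPolynomial.gradedAlgebra (σ := Fin (m + 1)) (R := ℚ);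
      𝔭.IsHomogeneous (homogeneousSubmodule (Fin (m + 1)) ℚ)) (hunm : IsUnmixedOfRank 𝔭 1)
    {b' : Fin (m + 1) → ℂ} (hb' : b' ∈ projZeros 𝔭) {j : Fin (m + 1)} (hj : b' j = 1)
    [NumberField ↥(IntermediateField.adjoin ℚ (Set.range b'))]
    {b : Fin (m + 1) → ↥(IntermediateField.adjoin ℚ (Set.range b'))} (hb : ∀ k, (b k : ℂ) = b' k) :
    Module.finrank ℚ ↥(IntermediateField.adjoin ℚ (Set.range b')) = ideg 𝔭 1 :=
  le_antisymm (finrank_le_ideg h𝔭 hhom hunm hb' hj hb) (ideg_le_finrank h𝔭 hhom hunm hb' hj)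

/-- **The associated form is `c ∏_σ ℓ_{σ(b̄)}`** over the complex embeddings `σ` of `K = ℚ(b̄')`.
[cite: NesterenkoPhilippon2001, Ch. 3 Prop. 4.4 (p. 38); HodgePedoe1994, Ch. X §7] -/
theorem exists_split_embeddings (h𝔭 : 𝔭.IsPrime)
    (hhom : letI := MvPolynomial.gradedAlgebra (σ := Fin (m + 1)) (R := ℚ);
      𝔭.IsHomogeneous (homogeneousSubmodule (Fin (m + 1)) ℚ)) (hunm : IsUnmixedOfRank 𝔭 1)
    {b' : Fin (m + 1) → ℂ} (hb' : b' ∈ projZeros 𝔭) {j : Fin (m + 1)} (hj : b' j = 1)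
    [NumberField ↥(IntermediateField.adjoin ℚ (Set.range b'))]
    {b : Fin (m + 1) → ↥(IntermediateField.adjoin ℚ (Set.range b'))} (hb : ∀ k, (b k : ℂ) = b' k) :
    ∃ c : ℂ, c ≠ 0 ∧ rename Prod.snd (map (algebraMap ℚ ℂ) (chowForm 𝔭 1)) =
      C c * ∏ σ : ↥(IntermediateField.adjoin ℚ (Set.range b')) →+* ℂ, (∑ k, C (σ (b k)) * X k) := by
  classical
  have hinj : Function.Injective
      (fun (σ : ↥(IntermediateField.adjoin ℚ (Set.range b')) →+* ℂ) (k : Fin (m + 1)) => σ (b k)) :=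
    fun σ τ h => embedding_eq_of_proportional hj hb σ τ 1 (by simpa using h)
  obtain ⟨hg0, -, -, hdeg⟩ := oneBlock_facts h𝔭 hhom hunm
  set S := (Finset.univ.image fun (σ : ↥(IntermediateField.adjoin ℚ (Set.range b')) →+* ℂ)
    (k : Fin (m + 1)) => σ (b k)) with hS
  have hS0 : ∀ β ∈ S, β ≠ 0 := by
    intro β hβ
    obtain ⟨σ, -, rfl⟩ := Finset.mem_image.mp hβ
    exact (map_mem_projZeros hb' hj hb σ).1
  have hsep : ∀ β ∈ S, ∀ β' ∈ S, β ≠ β' → ∀ c : ℂ, β' ≠ c • β := by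
    intro β hβ β' hβ' hne c hc
    obtain ⟨σ, -, rfl⟩ := Finset.mem_image.mp hβ
    obtain ⟨τ, -, rfl⟩ := Finset.mem_image.mp hβ'
    apply hne
    have : τ = σ := embedding_eq_of_proportional hj hb τ σ c (by
      funext k; simpa using congrFun hc k)
    rw [this]
  have hdvd : ∀ β ∈ S, ((∑ k, C (β k) * X k) : MvPolynomial (Fin (m + 1)) ℂ) ∣
      rename Prod.snd (map (algebraMap ℚ ℂ) (chowForm 𝔭 1)) := by
    intro β hβ
    obtain ⟨σ, -, rfl⟩ := Finset.mem_image.mp hβ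
    exact linC_map_dvd h𝔭 hhom hunm hb' hj hb σ
  obtain ⟨h, hh⟩ := prod_linC_dvd S hS0 hsep hdvd
  obtain ⟨hdegS, hS0'⟩ := totalDegree_prod_linC S hS0
  have hcard : S.card = ideg 𝔭 1 := by
    rw [hS, Finset.card_image_of_injective _ hinj, Finset.card_univ, NumberField.Embeddings.card,
      finrank_eq_ideg h𝔭 hhom hunm hb' hj hb]
  have hh0 : h ≠ 0 := by
    rintro rfl
    rw [mul_zero] at hh
    exact hg0 hh
  have hdegh : h.totalDegree = 0 := by
    have e := congrArg totalDegree hh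
    rw [totalDegree_mul_of_isDomain hS0' hh0, hdegS, hcard, hdeg] at e
    omega
  rw [totalDegree_eq_zero_iff_eq_C] at hdegh
  refine ⟨h.coeff 0, fun h0 => hh0 (by rw [hdegh, h0, C_0]), ?_⟩
  rw [hh, mul_comm, hS, Finset.prod_image fun σ _ τ _ e => hinj e]
  exact congrArg (fun x => x * _) hdegh

/-- **(A) The zeros of `𝔭` are exactly the multiples of the conjugates of `b̄`.**
[cite: NesterenkoPhilippon2001, Ch. 3 Prop. 4.4 (p. 38)] -/
theorem mem_projZeros_iff (h𝔭 : 𝔭.IsPrime)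
    (hhom : letI := MvPolynomial.gradedAlgebra (σ := Fin (m + 1)) (R := ℚ);
      𝔭.IsHomogeneous (homogeneousSubmodule (Fin (m + 1)) ℚ)) (hunm : IsUnmixedOfRank 𝔭 1)
    {b' : Fin (m + 1) → ℂ} (hb' : b' ∈ projZeros 𝔭) {j : Fin (m + 1)} (hj : b' j = 1)
    [NumberField ↥(IntermediateField.adjoin ℚ (Set.range b'))]
    {b : Fin (m + 1) → ↥(IntermediateField.adjoin ℚ (Set.range b'))} (hb : ∀ k, (b k : ℂ) = b' k)
    (β : Fin (m + 1) → ℂ) :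
    β ∈ projZeros 𝔭 ↔ β ≠ 0 ∧ ∃ (σ : ↥(IntermediateField.adjoin ℚ (Set.range b')) →+* ℂ) (l : ℂ),
      β = fun k => l * σ (b k) := by
  constructor
  · intro hβ
    obtain ⟨c, -, heq⟩ := exists_split_embeddings h𝔭 hhom hunm hb' hj hb
    obtain ⟨σ, l, rfl⟩ := exists_eq_smul_of_split h𝔭 hhom hunm
      (γ := fun (σ : ↥(IntermediateField.adjoin ℚ (Set.range b')) →+* ℂ) (k : Fin (m + 1)) => σ (b k))
      (fun σ => (map_mem_projZeros hb' hj hb σ).1) heq hβ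
    exact ⟨hβ.1, σ, l, rfl⟩
  · rintro ⟨hβ0, σ, l, rfl⟩
    have hl : l ≠ 0 := by
      rintro rfl
      apply hβ0
      funext k
      simp
    exact Literature.NumberTheory.Transcendental.PhilipponMain.smul_mem_projZeros
      (fun P hP k => homogeneousComponent_mem_of_mem hhom hP k) (map_mem_projZeros hb' hj hb σ) hl

end Field

/-! ### The registered sub-goal of this helper file -/

/-- **Registered sub-goal `stub_zeroDimDictionary_degree`** (crux `stmt-Schanuel-6117`, line
`orbit-interpolation-determinant`; the part of stub `stub_zeroDimDictionary` carried by this file):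
`[ℚ(b̄') : ℚ] = deg 𝔭` for a normalised zero `b̄'` of a homogeneous prime of rank `1`.
[cite: NesterenkoPhilippon2001, Ch. 3 Prop. 4.4 (p. 38)] -/
theorem stub_zeroDimDictionary_degree : ∀ (m : ℕ) (𝔭 : Ideal (Rx m)), 𝔭.IsPrime → (letI := MvPolynomial.gradedAlgebra (σ := Fin (m + 1)) (R := ℚ); 𝔭.IsHomogeneous (homogeneousSubmodule (Fin (m + 1)) ℚ)) → IsUnmixedOfRank 𝔭 1 → ∀ (b' : Fin (m + 1) → ℂ), b' ∈ projZeros 𝔭 → ∀ j : Fin (m + 1), b' j = 1 → Module.finrank ℚ ↥(IntermediateField.adjoin ℚ (Set.range b')) = ideg 𝔭 1 := by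
  intro m 𝔭 h𝔭 hhom hunm b' hb' j hj
  haveI := numberField_adjoin h𝔭 hhom hunm hb' hj
  exact finrank_eq_ideg h𝔭 hhom hunm hb' hj
    (b := fun k => ⟨b' k, IntermediateField.subset_adjoin ℚ _ ⟨k, rfl⟩⟩) fun _ => rfl

end Summit.Schanuel.Schanuel.Cruxes.ApproximationProperty.OrbitInterpolationDeterminant

end
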